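import Mathlib
import Summits.ResolutionOfSingularities.ResolutionOfSingularities.Theorems.AbhyankarShadowsSemivaluationShadowsHenselOverRuledShadowsRankOneHelpers2
import Summits.ResolutionOfSingularities.ResolutionOfSingularities.Theorems.AbhyankarShadowsRationalSuffices
import Literature.AlgebraicGeometry.Resolution.NormalizationFractions
import Literature.AlgebraicGeometry.Resolution.RankOneDensity
import HarnessLib

/-!
# Hensel-generated top layers: the shadow from a transported specialisation
(helpers for `stub_henselOverRuledShadowsRankOne`, III)

Support file for the registered stub `stub_henselOverRuledShadowsRankOne` of the crux
`stmt-ResolutionOfSingularities-16757` (`Theses.AbhyankarShadows.SemivaluationShadows`, line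
`birth`): the FINAL ASSEMBLY `HenselShadows.shadow_of_transport`, which is agnostic of how the
specialisation was built. Data: a saturation `V ⊇ O` of the rational rank-one `O` in `M ⊇ K`
(`V ∩ K = O`, residues constants), a ring map `Φ : E → M` on a subring `E ⊆ K` containing the
constants, the generators `s` of a first model `R₀ ⊇ R` and finitely many extra generators `G₀`,
with: `Φ(E)` inside an intermediate field `L ⊆ M` all of whose non-zero values are powers of
`V(π)`, `π = Φ(ẽ)` for a frame element `ẽ ∈ G₀` on which `Φ` is EXACT (`V(π) = ν(ẽ) < 1`),
every generator congruent to one constant modulo both maximal ideals, and every prescribed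
element `z` (generators minus constants, elements of `F`) carrying a witness `w ∈ K` with
`ν(w) = ν(z)` and `V(Φ z) = V(w)`. Conclusion: the crux's `HasShadow O R F` (unfolded), via the
model `R₁ = k[G₀ ∪ s]`, `φ = Φ|R₁ : R₁ → L`, bi-congruence (`HenselShadows.bicongruent_adjoin`)
and the one-element frame transfer `HenselShadows.frameShadow_one`. Also the DOWNSTAIRS ROOT
PACKAGE `HenselShadows.exists_root_package` (the root `ζ` of `h^φ` near `φ a`, its Hensel data,
and `m^φ(ζ) = 0` by the transport applied to the cofactor `g`).

No named facts are used. [folklore]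
-/

set_option linter.dupNamespace false

noncomputable section

open Polynomial Literature.AlgebraicGeometry.Resolution

namespace Summit.ResolutionOfSingularities.ResolutionOfSingularities.Theorems

namespace HenselShadows

/-- **The shadow from a transported specialisation** (module docstring): given the saturation
`V`, the ring map `Φ : E → M` into the intermediate field `L`, exactness witnesses on the
prescribed elements, bi-congruent generators and an exact frame element `ẽ ↦ π` whose value
generates the values of `L`, the datum `(k[G₀ ∪ s], L, Φ|, V ∩ L)` is a shadow of `(R, O)`
exact on `F`. [folklore] -/
theorem shadow_of_transport (k K M : Type) [Field k] [Field K] [Algebra k K] [Field M]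
    [Algebra K M] [Algebra k M] [IsScalarTower k K M] (O : ValuationSubring K)
    (hk : ∀ c : k, algebraMap k K c ∈ O)
    (hrat : ∀ x : K, x ∈ O → ∃ c : k, O.valuation (x - algebraMap k K c) < 1)
    (hrr : Module.finrank ℤ (Additive (O.ValueGroup)ˣ) = 1) (V : ValuationSubring M)
    (hVO : V.comap (algebraMap K M) = O)
    (hres : ∀ u : M, V.valuation u = 1 →
      ∃ c : k, V.valuation (u - algebraMap K M (algebraMap k K c)) < 1)
    (K₀ : IntermediateField k K) (Lf : IntermediateField K₀ M) (R R₀ : Subalgebra k K)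
    (hRR₀ : R ≤ R₀) (hR₀O : R₀.toSubring ≤ O.toSubring) (hfrac₀ : IsFractionRing R₀ K)
    (s : Finset K) (hs : Algebra.adjoin k (s : Set K) = R₀) (cst : K → k)
    (hcst : ∀ x ∈ s, O.valuation (x - algebraMap k K (cst x)) < 1)
    (E : Subring K) (hkE : ∀ c : k, algebraMap k K c ∈ E) (Φ : E →+* M)
    (hΦk : ∀ (c : k) (e : E), (e : K) = algebraMap k K c → Φ e = algebraMap k M c)
    (hΦLf : ∀ e : E, Φ e ∈ Lf) (G₀ : Finset K) (hG₀E : ∀ x ∈ G₀, x ∈ E)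
    (hG₀O : ∀ x ∈ G₀, x ∈ O)
    (hG₀c : ∀ x ∈ G₀, ∃ c : k, O.valuation (x - algebraMap k K c) < 1 ∧
      ∀ e : E, (e : K) = x → V.valuation (Φ e - algebraMap k M c) < 1)
    (hsE : ∀ x ∈ s, x ∈ E) (F : Finset R)
    (hZs : ∀ x ∈ s, x - algebraMap k K (cst x) ≠ 0 → ∃ w : K,
      O.valuation w = O.valuation (x - algebraMap k K (cst x)) ∧
        ∀ e : E, (e : K) = x - algebraMap k K (cst x) →
          V.valuation (Φ e) = V.valuation (algebraMap K M w))
    (hZF : ∀ x ∈ F, ((x : R) : K) ≠ 0 → ∃ w : K, O.valuation w = O.valuation ((x : R) : K) ∧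
        ∀ e : E, (e : K) = ((x : R) : K) → V.valuation (Φ e) = V.valuation (algebraMap K M w))
    (eK : K) (heG₀ : eK ∈ G₀) (he0 : eK ≠ 0) (he1 : O.valuation eK < 1) (π : M)
    (hπe : ∀ e : E, (e : K) = eK → Φ e = π)
    (hπex : V.valuation π = V.valuation (algebraMap K M eK))
    (hLval : ∀ w : M, w ∈ Lf → w ≠ 0 → ∃ n : ℤ, V.valuation w = V.valuation π ^ n) :
    ∃ (R₁ : Subalgebra k K) (hle : R ≤ R₁) (_ : R₁.toSubring ≤ O.toSubring), R₁.FG ∧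
    IsFractionRing R₁ K ∧ ∃ (L : Type) (_ : Field L) (_ : Algebra k L) (φ : R₁ →ₐ[k] L)
    (O' : ValuationSubring L), Module.finrank ℤ (Additive (O'.ValueGroup)ˣ) =
      Module.finrank ℤ (Additive (O.ValueGroup)ˣ) ∧ (∀ y : R₁, φ y ∈ O') ∧
    (∀ y : R₁, O'.valuation (φ y) < 1 ↔ O.valuation (y : K) < 1) ∧
    (∀ z : L, z ∈ O' → ∃ c : k, O'.valuation (z - algebraMap k L c) < 1) ∧
    (MonoidHom.mrange (O'.valuation.toMonoidWithZeroHom.toMonoidHom.comp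
      φ.toRingHom.toMonoidHom)).FG ∧
    ∃ ι : O'.ValueGroup →*₀o O.ValueGroup, Function.Injective ι ∧
      (∀ y : R₁, φ y ≠ 0 → ∃ y' : R₁, ι (O'.valuation (φ y)) = O.valuation (y' : K)) ∧
      ∀ x ∈ F, ι (O'.valuation (φ (Subalgebra.inclusion hle x))) = O.valuation ((x : R) : K) := by
  classical
  set ι : K →+* M := algebraMap K M with hιdef
  have hd : ∀ x : K, O.valuation x < 1 ↔ V.valuation (ι x) < 1 := fun x =>
    (valuation_map_lt_one_iff ι hVO x).symm
  have he : ∀ x x' : K, O.valuation x = O.valuation x' ↔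
      V.valuation (ι x) = V.valuation (ι x') := fun x x' => (valuation_map_eq_iff ι hVO x x').symm
  have hkO1 : ∀ c : k, O.valuation (algebraMap k K c) ≤ 1 := fun c =>
    (O.valuation_le_one_iff _).mpr (hk c)
  have hk1 : ∀ c : k, c ≠ 0 → O.valuation (algebraMap k K c) = 1 := fun c hc =>
    valuation_algebraMap_eq_one O hk hc
  have hkKM : ∀ c : k, ι (algebraMap k K c) = algebraMap k M c := fun c =>
    (IsScalarTower.algebraMap_apply k K M c).symm
  have hkV : ∀ c : k, algebraMap k M c ∈ V := fun c => by
    have h := hk c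
    rw [← hVO, ValuationSubring.mem_comap] at h
    rwa [← hkKM]
  have hkV1 : ∀ c : k, V.valuation (algebraMap k M c) ≤ 1 := fun c =>
    (V.valuation_le_one_iff _).mpr (hkV c)
  have hkM1 : ∀ c : k, c ≠ 0 → V.valuation (algebraMap k M c) = 1 := fun c hc => by
    rw [← hkKM]; exact (valuation_map_eq_one_iff ι hVO _).mpr (hk1 c hc)
  have hsR₀ : ∀ x ∈ s, x ∈ R₀ := fun x hx => hs ▸ Algebra.subset_adjoin hx
  have hsO : ∀ x ∈ s, x ∈ O := fun x hx => hR₀O (hsR₀ x hx)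
  /- the model `R₁ = k[G₀ ∪ s]` and `ψ₀ = Φ|R₁` -/
  set G : Finset K := G₀ ∪ s with hGdef
  set R₁ : Subalgebra k K := Algebra.adjoin k (G : Set K) with hR₁def
  have hGE : ∀ x ∈ G, x ∈ E := by
    intro x hx
    rcases Finset.mem_union.mp hx with hx | hx
    exacts [hG₀E x hx, hsE x hx]
  let Ek : Subalgebra k K := { E.toSubsemiring with algebraMap_mem' := hkE }
  have hEk : ∀ x : K, x ∈ Ek ↔ x ∈ E := fun x => Iff.rfl
  have hR₁E : R₁ ≤ Ek := Algebra.adjoin_le fun x hx => (hEk x).mpr (hGE x (Finset.mem_coe.mp hx))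
  have hR₁E' : ∀ y : R₁, (y : K) ∈ E := fun y => hR₁E y.2
  let ψr : R₁ →+* M :=
    { toFun := fun y => Φ ⟨y, hR₁E' y⟩
      map_one' := by rw [← map_one Φ]; rfl
      map_mul' := fun x y => by rw [← map_mul Φ]; rfl
      map_zero' := by rw [← map_zero Φ]; rfl
      map_add' := fun x y => by rw [← map_add Φ]; rfl }
  have hψrk : ∀ c : k, ψr (algebraMap k R₁ c) = algebraMap k M c := fun c =>
    hΦk c _ (Subalgebra.coe_algebraMap (S := R₁) c)
  let ψ₀ : R₁ →ₐ[k] M := { ψr with commutes' := hψrk }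
  have hψ₀ : ∀ y : R₁, ψ₀ y = Φ ⟨y, hR₁E' y⟩ := fun y => rfl
  /- the field `L` and `φ : R₁ → L` -/
  have hψLf : ∀ y : R₁, ψ₀ y ∈ Lf := fun y => hΦLf _
  let φL : R₁ →ₐ[k] Lf :=
    { toFun := fun y => ⟨ψ₀ y, hψLf y⟩
      map_one' := Subtype.ext (map_one ψ₀)
      map_mul' := fun x y => Subtype.ext (map_mul ψ₀ x y)
      map_zero' := Subtype.ext (map_zero ψ₀)
      map_add' := fun x y => Subtype.ext (map_add ψ₀ x y)
      commutes' := fun c => Subtype.ext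
        (show ψ₀ (algebraMap k R₁ c) = algebraMap k M c from AlgHom.commutes ψ₀ c) }
  have hφL : ∀ y : R₁, ((φL y : Lf) : M) = ψ₀ y := fun y => rfl
  set O' : ValuationSubring Lf := V.comap (algebraMap Lf M) with hO'def
  have hO'V : V.comap (algebraMap Lf M) = O' := rfl
  have hO'lt : ∀ z : Lf, O'.valuation z < 1 ↔ V.valuation (z : M) < 1 := fun z =>
    (valuation_map_lt_one_iff (algebraMap Lf M) hO'V z).symm
  have hO'eq : ∀ z z' : Lf, O'.valuation z = O'.valuation z' ↔
      V.valuation (z : M) = V.valuation (z' : M) := fun z z' =>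
    (valuation_map_eq_iff (algebraMap Lf M) hO'V z z').symm
  have hO'mem : ∀ z : Lf, z ∈ O' ↔ (z : M) ∈ V := fun _ => ValuationSubring.mem_comap
  /- [inside], [centre] by bi-congruence; [rational'] -/
  have hbi : ∀ y : R₁, ∃ c : k, O.valuation ((y : K) - algebraMap k K c) < 1 ∧
      V.valuation (ψ₀ y - algebraMap k M c) < 1 := by
    refine bicongruent_adjoin O.valuation V.valuation hkO1 hkV1 (G : Set K) ψ₀ ?_
    intro x hx
    have hx' : x ∈ G := Finset.mem_coe.mp hx
    rcases Finset.mem_union.mp hx' with hxG | hxs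
    · obtain ⟨c, hc1, hc2⟩ := hG₀c x hxG
      exact ⟨c, hc1, by rw [hψ₀]; exact hc2 _ rfl⟩
    · refine ⟨cst x, hcst x hxs, ?_⟩
      have hzE : x - algebraMap k K (cst x) ∈ E := E.sub_mem (hsE x hxs) (hkE _)
      have h1 : ψ₀ ⟨x, Algebra.subset_adjoin hx⟩ - algebraMap k M (cst x) =
          Φ ⟨x - algebraMap k K (cst x), hzE⟩ := by
        rw [hψ₀, ← hΦk (cst x) ⟨_, hkE (cst x)⟩ rfl, ← map_sub]
        rfl
      rw [h1]
      by_cases hz0 : x - algebraMap k K (cst x) = 0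
      · have : (⟨x - algebraMap k K (cst x), hzE⟩ : E) = 0 := Subtype.ext hz0
        rw [this, map_zero, map_zero]
        exact zero_lt_one
      · obtain ⟨w, hνw, hΦw⟩ := hZs x hxs hz0
        rw [hΦw _ rfl, ← hd, hνw]
        exact hcst x hxs
  have hin : ∀ y : R₁, φL y ∈ O' := fun y => by
    rw [hO'mem, hφL, ← V.valuation_le_one_iff]
    obtain ⟨c, -, hc⟩ := hbi y
    exact le_one_of_cong V.valuation hkV1 hc
  have hcen : ∀ y : R₁, O'.valuation (φL y) < 1 ↔ O.valuation (y : K) < 1 := fun y => by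
    obtain ⟨c, hc1, hc2⟩ := hbi y
    rw [hO'lt, hφL, RuledAbh.lt_one_iff V.valuation hkM1 hc2,
      RuledAbh.lt_one_iff O.valuation hk1 hc1]
  have hrat' : ∀ z : Lf, z ∈ O' → ∃ c : k, O'.valuation (z - algebraMap k Lf c) < 1 := by
    intro z hz
    rw [hO'mem] at hz
    by_cases hz1 : V.valuation (z : M) < 1
    · exact ⟨0, by rw [map_zero, sub_zero, hO'lt]; exact hz1⟩
    · have hz1' : V.valuation (z : M) = 1 :=
        le_antisymm ((V.valuation_le_one_iff _).mpr hz) (not_lt.mp hz1)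
      obtain ⟨c, hc⟩ := hres _ hz1'
      refine ⟨c, ?_⟩
      rw [hO'lt]
      have : ((z - algebraMap k Lf c : Lf) : M) = (z : M) - ι (algebraMap k K c) := by
        rw [hkKM]; rfl
      rw [this]
      exact hc
  /- the frame element and the value group -/
  have heR₁ : eK ∈ R₁ := Algebra.subset_adjoin (Finset.mem_union_left _ heG₀)
  set eR : R₁ := ⟨eK, heR₁⟩ with heRdef
  have hψ₀e : ψ₀ eR = π := by rw [hψ₀]; exact hπe _ rfl
  have hπ1V : V.valuation π < 1 := by rw [hπex]; exact (hd _).mp he1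
  have hπ0 : π ≠ 0 := by
    intro h0
    rw [h0, map_zero, eq_comm, Valuation.zero_iff, map_eq_zero] at hπex
    exact he0 hπex
  have hcoezpow : ∀ (x : Lf) (n : ℤ), ((x ^ n : Lf) : M) = (x : M) ^ n := fun x n =>
    map_zpow₀ (algebraMap Lf M) x n
  have hgenL : ∀ z : Lf, z ≠ 0 → ∃ n : ℤ, O'.valuation z = O'.valuation (φL eR) ^ n := by
    intro z hz0
    obtain ⟨n, hn⟩ := hLval z z.2 fun h0 => hz0 (Subtype.ext h0)
    refine ⟨n, ?_⟩
    rw [← map_zpow₀, hO'eq, hn, hcoezpow, hφL, hψ₀e, map_zpow₀]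
  have hφe0 : φL eR ≠ 0 := by
    intro h0
    apply hπ0
    have := congrArg (fun z : Lf => (z : M)) h0
    rw [hφL, hψ₀e] at this
    exact this
  have hφe1 : O'.valuation (φL eR) < 1 := by rw [hO'lt, hφL, hψ₀e]; exact hπ1V
  /- the model clauses -/
  have hR₀R₁ : R₀ ≤ R₁ := by
    rw [← hs]
    exact Algebra.adjoin_mono fun x hx => Finset.mem_union_right _ (Finset.mem_coe.mp hx)
  have hle₁ : R ≤ R₁ := hRR₀.trans hR₀R₁
  have h₁O : R₁.toSubring ≤ O.toSubring := by
    let Ok : Subalgebra k K := { O.toSubring.toSubsemiring with algebraMap_mem' := fun c => hk c }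
    have hle' : R₁ ≤ Ok := by
      refine Algebra.adjoin_le fun x hx => ?_
      rcases Finset.mem_union.mp (Finset.mem_coe.mp hx) with hxG | hxs
      exacts [hG₀O x hxG, hsO x hxs]
    exact fun x hx => hle' hx
  have hfg₁ : R₁.FG := ⟨G, rfl⟩
  haveI := hfrac₀
  have hfrac₁ : IsFractionRing R₁ K :=
    isFractionRing_of_forall_exists_div R₁.toSubring fun z => by
      obtain ⟨a', s', -, hz⟩ := IsFractionRing.div_surjective (A := R₀) z
      exact ⟨a', hR₀R₁ a'.2, s', hR₀R₁ s'.2, by rw [← hz]; rfl⟩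
  /- exactness on `F` -/
  have hexF : ∀ x ∈ F, ((x : R) : K) ≠ 0 → φL (Subalgebra.inclusion hle₁ x) ≠ 0 ∧
      ∃ n : ℤ, O'.valuation (φL (Subalgebra.inclusion hle₁ x)) = O'.valuation (φL eR) ^ n ∧
        O.valuation ((x : R) : K) = O.valuation ((eR : R₁) : K) ^ n := by
    intro x hxF hx0
    obtain ⟨w, hνw, hΦw⟩ := hZF x hxF hx0
    have hval : V.valuation ((φL (Subalgebra.inclusion hle₁ x) : Lf) : M) =
        V.valuation (ι w) := by
      rw [hφL, hψ₀]
      exact hΦw _ rfl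
    have hw0 : V.valuation (ι w) ≠ 0 := by
      rw [Valuation.ne_zero_iff, _root_.map_ne_zero]
      intro h0
      rw [h0, map_zero, eq_comm, Valuation.zero_iff] at hνw
      exact hx0 hνw
    have hne : φL (Subalgebra.inclusion hle₁ x) ≠ 0 := by
      intro h0
      rw [h0] at hval
      simp only [ZeroMemClass.coe_zero, map_zero] at hval
      exact hw0 hval.symm
    obtain ⟨n, hn⟩ := hgenL _ hne
    refine ⟨hne, n, hn, ?_⟩
    have hn' : V.valuation ((φL (Subalgebra.inclusion hle₁ x) : Lf) : M) = V.valuation π ^ n := by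
      rw [← map_zpow₀, hO'eq, hcoezpow, hφL eR, hψ₀e, map_zpow₀] at hn
      exact hn
    rw [hval, hπex, ← map_zpow₀, ← map_zpow₀] at hn'
    have := (he _ _).mpr hn'
    rw [hνw, map_zpow₀] at this
    exact this
  exact frameShadow_one k K O hk hrat hrr R R₁ hle₁ h₁O hfg₁ hfrac₁ Lf φL O' hin hcen hrat' eR
    he0 he1 hφe0 hφe1 hgenL F hexF

/-! ## The downstairs root package -/

/-- **The downstairs root `ζ`.** Setting of the top-layer transport: `ι⁻¹(V) = O`, ring maps
`i : D → K`, `φ : D → M` (`M` algebraically closed), the relation `h = m · g` lifted to `D[X]`,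
the Newton approximant `a ∈ D` and the constant `c` (`v_K(i(a - c)) < 1`), with `φ` EXACT on
the coefficients of `h`, on `a`, `a - c`, `h(a)`, `h'(a)`, `g(a)` and the coefficients of `g`,
`h'(a)` a unit and `h(a)` of value `< 1` upstairs, and the GAP `v(b_g h(a)) < v(g(a))`. Then the
root `ζ` of `h^φ` near `φ a` (`exists_root_near`) lies in `V`, is congruent to `φ c`, is a
Hensel root of `h^φ` (coefficients in `V`, unit derivative), satisfies
`V(ζ - φ a) ≤ V(ι i h(a))`, and is a root of `m^φ` — because `g^φ(ζ) ≠ 0` by the TRANSPORT.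
[folklore] -/
theorem exists_root_package {K M D : Type*} [Field K] [Field M] [IsAlgClosed M] [CommRing D]
    (O : ValuationSubring K) (V : ValuationSubring M) (ι : K →+* M) (hVO : V.comap ι = O)
    (i : D →+* K) (φ : D →+* M) (hD mD gD : D[X]) (a c : D) (bg : K) (hfac : hD = mD * gD)
    (hcoefO : ∀ n, i (hD.coeff n) ∈ O)
    (hexh : ∀ n, V.valuation (φ (hD.coeff n)) = V.valuation (ι (i (hD.coeff n))))
    (hexg : ∀ n, V.valuation (φ (gD.coeff n)) = V.valuation (ι (i (gD.coeff n))))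
    (hexa : V.valuation (φ a) = V.valuation (ι (i a))) (haO : i a ∈ O)
    (hexha : V.valuation (φ (hD.eval a)) = V.valuation (ι (i (hD.eval a))))
    (hexda : V.valuation (φ ((derivative hD).eval a)) =
      V.valuation (ι (i ((derivative hD).eval a))))
    (hexga : V.valuation (φ (gD.eval a)) = V.valuation (ι (i (gD.eval a))))
    (hexac : V.valuation (φ (a - c)) = V.valuation (ι (i (a - c))))
    (hunit : O.valuation (i ((derivative hD).eval a)) = 1)
    (hha1 : O.valuation (i (hD.eval a)) < 1) (hac : O.valuation (i (a - c)) < 1)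
    (hbg : ∀ n, O.valuation (i (gD.coeff n)) ≤ O.valuation bg)
    (hgapg : O.valuation (bg * i (hD.eval a)) < O.valuation (i (gD.eval a)))
    (hga : i (gD.eval a) ≠ 0) :
    ∃ ζ : M, ζ ∈ V ∧ (hD.map φ).eval ζ = 0 ∧ (mD.map φ).eval ζ = 0 ∧
      V.valuation (ζ - φ c) < 1 ∧ (∀ n, (hD.map φ).coeff n ∈ V) ∧
      V.valuation ((derivative (hD.map φ)).eval ζ) = 1 ∧
      V.valuation (ζ - φ a) ≤ V.valuation (ι (i (hD.eval a))) := by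
  have hd : ∀ x : K, O.valuation x < 1 ↔ V.valuation (ι x) < 1 := fun x =>
    (valuation_map_lt_one_iff ι hVO x).symm
  have hιV : ∀ x : K, ι x ∈ V ↔ x ∈ O := fun x => by rw [← ValuationSubring.mem_comap, hVO]
  obtain ⟨ζ, hζroot, hζa⟩ := exists_root_near O V ι hVO i φ hD a hexha hexda hunit
  have hφaV : φ a ∈ V := by
    rw [← V.valuation_le_one_iff, hexa, V.valuation_le_one_iff, hιV]
    exact haO
  have hζa1 : V.valuation (ζ - φ a) < 1 := lt_of_le_of_lt hζa ((hd _).mp hha1)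
  have hζV : ζ ∈ V := by
    have h1 : ζ = (ζ - φ a) + φ a := by ring
    rw [h1]
    exact add_mem ((V.valuation_le_one_iff _).mp hζa1.le) hφaV
  have hφac : V.valuation (φ a - φ c) < 1 := by
    rw [← map_sub, hexac]
    exact (hd _).mp hac
  have hζc : V.valuation (ζ - φ c) < 1 := by
    have h1 : ζ - φ c = (ζ - φ a) + (φ a - φ c) := by ring
    rw [h1]
    exact Valuation.map_add_lt _ hζa1 hφac
  have hhφV : ∀ n, (hD.map φ).coeff n ∈ V := by
    intro n
    rw [coeff_map, ← V.valuation_le_one_iff, hexh n, V.valuation_le_one_iff, hιV]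
    exact hcoefO n
  have hhφder : V.valuation ((derivative (hD.map φ)).eval ζ) = 1 := by
    have hdφa : (derivative (hD.map φ)).eval (φ a) = φ ((derivative hD).eval a) := by
      rw [derivative_map, eval_map, eval₂_hom]
    have hu : V.valuation ((derivative (hD.map φ)).eval (φ a)) = 1 := by
      rw [hdφa, hexda]
      exact (valuation_map_eq_one_iff ι hVO _).mpr hunit
    have hdcoef : ∀ n, (derivative (hD.map φ)).coeff n ∈ V :=
      coeff_derivative_mem_valuationSubring V hhφV
    have h1 : V.valuation ((derivative (hD.map φ)).eval ζ -
        (derivative (hD.map φ)).eval (φ a)) < 1 :=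
      lt_of_le_of_lt (valuation_eval_sub_eval_le V hdcoef hζV hφaV) hζa1
    have h2 : (derivative (hD.map φ)).eval ζ = ((derivative (hD.map φ)).eval ζ -
        (derivative (hD.map φ)).eval (φ a)) + (derivative (hD.map φ)).eval (φ a) := by ring
    rw [h2, Valuation.map_add_eq_of_lt_right, hu]
    rwa [hu]
  -- the cofactor does not vanish at `ζ` (transport), hence `m^φ(ζ) = 0`
  have hgφ : (gD.map φ).eval ζ ≠ 0 := by
    intro h0
    have h1 := transport O V ι hVO i φ gD a bg (i (hD.eval a)) ζ hexg hexa haO hexga hbg hζV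
      hζa hgapg
    rw [h0, map_zero, eq_comm, Valuation.zero_iff, map_eq_zero] at h1
    exact hga h1
  have hmφζ : (mD.map φ).eval ζ = 0 := by
    have h1 : (hD.map φ).eval ζ = (mD.map φ).eval ζ * (gD.map φ).eval ζ := by
      rw [hfac, Polynomial.map_mul, eval_mul]
    rw [hζroot] at h1
    exact (mul_eq_zero.mp h1.symm).resolve_right hgφ
  exact ⟨ζ, hζV, hζroot, hmφζ, hζc, hhφV, hhφder, hζa⟩

end HenselShadows

end Summit.ResolutionOfSingularities.ResolutionOfSingularities.Theorems

end
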